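import Mathlib.Computability.TuringMachine.Computable
import Literature.Computability.FineGrained.FineGrainedWave0
import Literature.Computability.Complexity.TimeBounds
import Literature.Computability.Complexity.BoolEncodings
import Literature.Computability.Complexity.CNF
import HarnessLib

-- provenance: harness21/H21/H21/Statements/PNP/ExponentialTime.lean @ 01d621f (interim HEAD d8f2665); M5 mechanical rewrite
/-!
# P vs NP family: the Exponential Time Hypothesis in the `CplxCore` model

Family `pnp` (trunk T-CPLX-FINE / CplxCore), statement **pnp.S34**:

> ETH: `s₃ = inf {δ : 3-SAT ∈ TIME(2^{δ n})} > 0` (`n` = number of variables).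

The hypothesis itself is already the constant `Literature.Computability.FineGrained.ETH`
(`H21/Statements/FineGrained/Wave0.lean`, **fine-grained.S02**), stated over the `Γ'`-encoded
structure `FineGrained.KCNF 3` and Wave0's own `FineGrained.ComputesInTime`. This file defines
**no new `ETH` constant**; it records

* `eth_iff_kSAT_three`: the bridge between Wave0's model and the `CplxCore` model of the `pnp`
  family, in which 3-SAT is the set `{φ : CplxCore.CNF ℕ | φ.IsWidthLE 3 ∧ φ.Satisfiable}`
  (the preimage of the language `CplxCore.kSAT 3 ⊆ {0,1}*`) with the Boolean encoding
  `CplxCore.encodingCNF`, decided by a machine in the sense of `CplxCore.DecidesInTime` with the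
  instance-dependent bound `T (φ.numVars) |encode φ|`, `T = O(2^{δ n} · poly(L))`
  (`FineGrained.IsExpPolyBound δ T`);
* `eth_iff_satExponent_three_pos'`: the printed form `ETH ↔ s₃ > 0`, a direct re-export of
  `FineGrained.eth_iff_satExponent_pos`.

## Design notes

* We do **not** import `Literature.Statements.PNP.Wave0` (its `P`/`NP` would clash with
  `CplxCore.P`/`CplxCore.NP` under `open`); nothing from it is needed.
* The two models differ only by polynomial-time translations of the encodings
  (`KCNF.encode` over `Γ'` versus `encodingCNF.encode` over `Bool`; a `KCNF 3` carries an
  explicit `numVars ≥ CNF.numVars clauses`, and conversely `CNF.numVars` is `1 + ` the largest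
  variable index), so "3-SAT ∈ TIME(2^{δ n} · poly(L)) for every / some δ in a downward closed
  range" is the same statement in both; the `poly(L)` slack in `IsExpPolyBound` absorbs the
  translation costs and the multi-stack-TM simulation overheads. Hence the equivalence is a
  routine (but long) machine construction and is left `sorry`.
* Mathlib search: Mathlib has `Turing.TM2ComputableInTime`, `Turing.TM2ComputableInPolyTime`
  (input-length time bounds only) and no k-SAT / ETH notions (`rg ETH|kSAT|satExponent` in
  `Mathlib/Computability` finds nothing relevant); all notions used here come from the accepted
  H21 files listed in the imports.

## References

* R. Impagliazzo, R. Paturi, *On the complexity of k-SAT*, JCSS 62 (2001), §1.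
* R. Impagliazzo, R. Paturi, F. Zane, *Which problems have strongly exponential complexity?*,
  JCSS 63 (2001), §1.
-/

namespace Literature.Computability.Complexity

open _root_.Computability Turing

/-- **pnp.S34** ETH: `s₃ = inf{δ : 3-SAT ∈ TIME(2^{δ n})} > 0`, `n` = number of variables
(Impagliazzo–Paturi, JCSS 62 (2001), §1; Impagliazzo–Paturi–Zane, JCSS 63 (2001), §1).
Bridge form: Wave0's `FineGrained.ETH` (3-SAT as `Γ'`-encoded `KCNF 3`) is equivalent to the
`CplxCore` phrasing "for some `δ > 0`, no multi-stack machine decides the set of satisfiable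
width-`≤ 3` CNFs over `ℕ` (Boolean encoding `encodingCNF`) within `T n L` steps for any
`T = O(2^{δ n} · poly(L))`", where `n = φ.numVars` and `L` is the length of the encoding of `φ`.
The two models agree up to `poly(L)` factors (polynomial-time re-encodings); this robustness
of ETH under polynomial-overhead re-encodings and machine simulations is standard (no single
source; cf. Impagliazzo–Paturi–Zane, JCSS 63 (2001), §1); not yet discharged in the tree.
[folklore] -/
def eth_iff_kSAT_three : Prop :=
  FineGrained.ETH ↔
      ∃ δ : ℝ, 0 < δ ∧
        ¬ ∃ (T : ℕ → ℕ → ℕ) (M : TM2ComputableAux Bool Bool),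
          FineGrained.IsExpPolyBound δ T ∧
            DecidesInTime encodingCNF.encode
              {φ : CNF ℕ | φ.IsWidthLE 3 ∧ φ.Satisfiable}
              (fun φ => T φ.numVars (encodingCNF.encode φ).length) M

/-- **pnp.S34** ETH in its printed form: `ETH ↔ s₃ > 0`, where
`s₃ = FineGrained.satExponent 3 = inf {δ ≥ 0 : 3-SAT ∈ TIME(2^{δ n} · poly(L))}`.
This is `FineGrained.eth_iff_satExponent_pos` (**fine-grained.S02**), re-exported in the `pnp`
namespace. (Impagliazzo–Paturi, JCSS 62 (2001), §1; Impagliazzo–Paturi–Zane, JCSS 63 (2001).) [folklore] -/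
def eth_iff_satExponent_three_pos' : Prop :=
  FineGrained.ETH ↔ 0 < FineGrained.satExponent 3

/- interim proof relied on results that are now named facts (D-0014); demoted to a fact by the M5 import, proof preserved:
:=
  FineGrained.eth_iff_satExponent_pos
-/

end Literature.Computability.Complexity
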